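import Mathlib.MeasureTheory.Measure.Haar.Unique
import Literature.MathematicalPhysics.KineticTheory.HardSphereEulerLLN
import Literature.Analysis.FluidPDE.HardSpherePhaseSpaceProofs

/-!
# Mesoscopic LLN for local Gibbs states — II: mesoscopic kernels on `𝕋³`

Helper file for item stmt-AtomisticToContinuum-9524 (`MesoscopicLLN`).

Elementary harmonic analysis of the admissible kernel families `φ_N` of the statement (continuous,
`≥ 0`, mass `1`, supported in the minimal-image ball of radius `r_N → 0`):

* Haar calculus on `𝕋³`: `∫ φ(y - x) dx = ∫ φ(x - y) dx = ∫ φ` (`integral_comp_sub_left`,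
  `integral_comp_sub_right`; negation invariance of the Haar probability measure);
  `euclidDist (y - x) 0 = euclidDist y x`.
* uniform continuity in the minimal-image distance (`exists_forall_euclidDist_lt_norm_sub_lt`:
  Mathlib's sup distance is dominated by `euclidDist`, `norm_sub_le_euclidDist_holds`);
* **mollification is uniformly close to the identity** (`abs_integral_translate_mul_sub_le`,
  `abs_integral_mul_translate_sub_le`): if `|f x - f y| ≤ η` whenever `euclidDist x y < r` then
  `|∫ φ(y - x) f(y) dy - f(x)| ≤ η` and `|∫ f(x) φ(y - x) dx - f(y)| ≤ η`;
* **the cluster integrand converges uniformly** (`abs_Jint_sub_le`): the rescaled cluster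
  integrand `J_ε(y₀)` of `HardSphereCanonicalTorus` is within `k η ∫ domF` of `b_k β(y₀)^k` as soon
  as `β` varies by at most `η` on the scale `k ε` (the tree's `tendsto_Jint` is the pointwise
  statement, by dominated convergence; uniformity comes from the uniform continuity of `β`).

References: Spohn 1991, Part I §2.3; Pulvirenti–Tsagkarogiannis 2012 §5.
-/

namespace Summit.AtomisticToContinuum.HydrodynamicLimit.Theorems.MesoLLN

open MeasureTheory ProbabilityTheory Finset Filter Topology
open Literature.Probability.LatticeModels Literature.MathematicalPhysics.StatisticalMechanics
open Literature.MathematicalPhysics.KineticTheory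
open Literature.Analysis.FluidPDE (Config)
open Literature.Analysis.FluidPDE.Torus (euclidDist reprSym)
open Literature.Analysis.FunctionSpaces (Torus.proj)
open scoped ENNReal

noncomputable section

/-! ### Haar calculus on `𝕋³` -/

/-- The Haar probability measure of `𝕋³` is invariant under negation (abelian compact group). -/
theorem isNegInvariant_volume_T3 : (volume : Measure T3).IsNegInvariant :=
  Measure.IsAddHaarMeasure.isNegInvariant_of_regular (volume : Measure T3)

/-- `∫ φ(y - x) dx = ∫ φ`. -/
theorem integral_comp_sub_left {F : Type*} [NormedAddCommGroup F] [NormedSpace ℝ F]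
    (φ : T3 → F) (y : T3) : ∫ x, φ (y - x) = ∫ x, φ x := by
  haveI := isNegInvariant_volume_T3
  exact integral_sub_left_eq_self φ volume y

/-- `∫ φ(x - y) dx = ∫ φ`. -/
theorem integral_comp_sub_right {F : Type*} [NormedAddCommGroup F] [NormedSpace ℝ F]
    (φ : T3 → F) (y : T3) : ∫ x, φ (x - y) = ∫ x, φ x :=
  integral_sub_right_eq_self φ y

/-- `euclidDist (y - x) 0 = euclidDist y x`. -/
theorem euclidDist_sub_zero (y x : T3) : euclidDist (y - x) 0 = euclidDist y x := by
  rw [Literature.Analysis.FluidPDE.Torus.euclidDist_eq, Literature.Analysis.FluidPDE.Torus.euclidDist_eq, sub_zero]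

/-- A translate along the covering map moves a point by at most the length of the lift:
`euclidDist (y + proj q) y ≤ ‖q‖`. -/
theorem euclidDist_add_proj_le (y : T3) (q : E3) : euclidDist (y + Torus.proj q) y ≤ ‖q‖ := by
  rw [Literature.Analysis.FluidPDE.Torus.euclidDist_eq, add_sub_cancel_left]
  exact Literature.Analysis.FluidPDE.Torus.norm_reprSym_le_of_proj_eq rfl

/-! ### Uniform continuity in the minimal-image distance -/

/-- **Uniform continuity on `𝕋³` in the minimal-image distance**: a continuous function into a
normed group varies by less than `η` on minimal-image balls of a suitable radius `δ > 0`
(compactness; Mathlib's sup distance is dominated by `euclidDist`). -/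
theorem exists_forall_euclidDist_lt_norm_sub_lt {F : Type*} [NormedAddCommGroup F] {f : T3 → F}
    (hf : Continuous f) {η : ℝ} (hη : 0 < η) :
    ∃ δ : ℝ, 0 < δ ∧ ∀ x y, euclidDist x y < δ → ‖f x - f y‖ < η := by
  have hu : UniformContinuous f := CompactSpace.uniformContinuous_of_continuous hf
  obtain ⟨δ, hδ, hδf⟩ := Metric.uniformContinuous_iff.1 hu η hη
  refine ⟨δ, hδ, fun x y hxy => ?_⟩
  have hd : dist x y < δ := by
    rw [dist_eq_norm]
    exact (Literature.Analysis.FluidPDE.Torus.norm_sub_le_euclidDist_holds x y).trans_lt hxy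
  have := hδf hd
  rwa [dist_eq_norm] at this

/-! ### Mollification by an admissible kernel -/

section Mollify

variable {φ : T3 → ℝ} {r : ℝ}

/-- A continuous function on `𝕋³` is integrable. -/
theorem integrable_T3 {F : Type*} [NormedAddCommGroup F] {g : T3 → F} (hg : Continuous g) :
    Integrable g := integrable_of_continuous_T3 hg

/-- Off the minimal-image ball of radius `r` around `x` the translate `φ(· - x)` vanishes. -/
theorem translate_eq_zero (hsupp : ∀ y, r ≤ euclidDist y 0 → φ y = 0) {x y : T3}
    (hxy : r ≤ euclidDist y x) : φ (y - x) = 0 :=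
  hsupp _ (by rwa [euclidDist_sub_zero])

/-- **Mollification, first form**: for a continuous kernel `φ ≥ 0` of mass `1` supported in the
minimal-image ball of radius `r`, and `f` with `|f x - f y| ≤ η` whenever `euclidDist y x < r`,
`|∫ φ(y - x) f(y) dy - f(x)| ≤ η` for every `x`. -/
theorem abs_integral_translate_mul_sub_le (hφc : Continuous φ) (hφ0 : ∀ y, 0 ≤ φ y)
    (hφ1 : ∫ y, φ y = 1) (hsupp : ∀ y, r ≤ euclidDist y 0 → φ y = 0) {f : T3 → ℝ}
    (hf : Continuous f) {η : ℝ} (hmod : ∀ x y, euclidDist y x < r → |f y - f x| ≤ η) (x : T3) :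
    |(∫ y, φ (y - x) * f y) - f x| ≤ η := by
  have hφx : Continuous fun y => φ (y - x) := hφc.comp (continuous_id.sub continuous_const)
  have h1 : ∫ y, φ (y - x) = 1 := by rw [integral_comp_sub_right φ x, hφ1]
  have hrepr : (∫ y, φ (y - x) * f y) - f x = ∫ y, φ (y - x) * (f y - f x) := by
    have hfx : f x = ∫ y, φ (y - x) * f x := by rw [integral_mul_const, h1, one_mul]
    calc (∫ y, φ (y - x) * f y) - f x = (∫ y, φ (y - x) * f y) - ∫ y, φ (y - x) * f x := by
          rw [← hfx]
      _ = ∫ y, φ (y - x) * (f y - f x) := by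
          have hi1 : Integrable (fun y => φ (y - x) * f y) := integrable_T3 (hφx.mul hf)
          have hi2 : Integrable (fun y => φ (y - x) * f x) := integrable_T3 (hφx.mul continuous_const)
          rw [← integral_sub hi1 hi2]
          refine integral_congr_ae (ae_of_all _ fun y => ?_)
          ring
  rw [hrepr]
  calc |∫ y, φ (y - x) * (f y - f x)| ≤ ∫ y, |φ (y - x) * (f y - f x)| := abs_integral_le_integral_abs
    _ ≤ ∫ y, φ (y - x) * η := by
        have hi1 : Integrable (fun y => φ (y - x) * (f y - f x)) :=
          integrable_T3 (hφx.mul (hf.sub continuous_const))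
        have hi2 : Integrable (fun y => φ (y - x) * η) := integrable_T3 (hφx.mul continuous_const)
        refine integral_mono hi1.abs hi2 fun y => ?_
        dsimp only
        rw [abs_mul, abs_of_nonneg (hφ0 _)]
        by_cases hyx : euclidDist y x < r
        · exact mul_le_mul_of_nonneg_left (hmod x y hyx) (hφ0 _)
        · rw [translate_eq_zero hsupp (le_of_not_gt hyx), zero_mul, zero_mul]
    _ = η := by rw [integral_mul_const, h1, one_mul]

/-- **Mollification, second form** (the kernel acting on the other variable):
`|∫ f(x) φ(y - x) dx - f(y)| ≤ η` for every `y`, under the same hypotheses. -/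
theorem abs_integral_mul_translate_sub_le (hφc : Continuous φ) (hφ0 : ∀ y, 0 ≤ φ y)
    (hφ1 : ∫ y, φ y = 1) (hsupp : ∀ y, r ≤ euclidDist y 0 → φ y = 0) {f : T3 → ℝ}
    (hf : Continuous f) {η : ℝ} (hmod : ∀ x y, euclidDist y x < r → |f y - f x| ≤ η) (y : T3) :
    |(∫ x, f x * φ (y - x)) - f y| ≤ η := by
  have hφy : Continuous fun x => φ (y - x) := hφc.comp (continuous_const.sub continuous_id)
  have h1 : ∫ x, φ (y - x) = 1 := by rw [integral_comp_sub_left φ y, hφ1]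
  have hrepr : (∫ x, f x * φ (y - x)) - f y = ∫ x, φ (y - x) * (f x - f y) := by
    have hfy : f y = ∫ x, φ (y - x) * f y := by rw [integral_mul_const, h1, one_mul]
    calc (∫ x, f x * φ (y - x)) - f y = (∫ x, f x * φ (y - x)) - ∫ x, φ (y - x) * f y := by
          rw [← hfy]
      _ = ∫ x, φ (y - x) * (f x - f y) := by
          have hi1 : Integrable (fun x => f x * φ (y - x)) := integrable_T3 (hf.mul hφy)
          have hi2 : Integrable (fun x => φ (y - x) * f y) := integrable_T3 (hφy.mul continuous_const)
          rw [← integral_sub hi1 hi2]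
          refine integral_congr_ae (ae_of_all _ fun x => ?_)
          ring
  rw [hrepr]
  calc |∫ x, φ (y - x) * (f x - f y)| ≤ ∫ x, |φ (y - x) * (f x - f y)| := abs_integral_le_integral_abs
    _ ≤ ∫ x, φ (y - x) * η := by
        have hi1 : Integrable (fun x => φ (y - x) * (f x - f y)) :=
          integrable_T3 (hφy.mul (hf.sub continuous_const))
        have hi2 : Integrable (fun x => φ (y - x) * η) := integrable_T3 (hφy.mul continuous_const)
        refine integral_mono hi1.abs hi2 fun x => ?_
        dsimp only
        rw [abs_mul, abs_of_nonneg (hφ0 _)]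
        by_cases hyx : euclidDist y x < r
        · have hxy : euclidDist x y < r := by
            rwa [Literature.Analysis.FluidPDE.Torus.euclidDist_comm]
          exact mul_le_mul_of_nonneg_left (hmod y x hxy) (hφ0 _)
        · rw [translate_eq_zero hsupp (le_of_not_gt hyx), zero_mul, zero_mul]
    _ = η := by rw [integral_mul_const, h1, one_mul]

/-- The translates of a kernel of mass one have mass one: `∫ φ(y - x) dx = 1`. -/
theorem integral_translate_eq_one (hφ1 : ∫ y, φ y = 1) (y : T3) : ∫ x, φ (y - x) = 1 := by
  rw [integral_comp_sub_left φ y, hφ1]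

/-- And in the other variable: `∫ φ(y - x) dy = 1`. -/
theorem integral_translate_eq_one' (hφ1 : ∫ y, φ y = 1) (x : T3) : ∫ y, φ (y - x) = 1 := by
  rw [integral_comp_sub_right φ x, hφ1]

end Mollify

/-! ### Products of close bounded factors -/

/-- `|∏ a - ∏ b| ≤ #s · M^{#s} · η` if `|aᵢ|, |bᵢ| ≤ M`, `|aᵢ - bᵢ| ≤ η` and `1 ≤ M`. -/
theorem abs_prod_sub_prod_le {ι : Type*} (s : Finset ι) {a b : ι → ℝ} {M η : ℝ} (hM : 1 ≤ M)
    (hη : 0 ≤ η) (ha : ∀ i ∈ s, |a i| ≤ M) (hb : ∀ i ∈ s, |b i| ≤ M)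
    (hab : ∀ i ∈ s, |a i - b i| ≤ η) :
    |∏ i ∈ s, a i - ∏ i ∈ s, b i| ≤ s.card * M ^ s.card * η := by
  classical
  induction s using Finset.induction_on with
  | empty => simp
  | insert i s hi ih =>
    have ha' : ∀ j ∈ s, |a j| ≤ M := fun j hj => ha j (mem_insert_of_mem hj)
    have hb' : ∀ j ∈ s, |b j| ≤ M := fun j hj => hb j (mem_insert_of_mem hj)
    have hab' : ∀ j ∈ s, |a j - b j| ≤ η := fun j hj => hab j (mem_insert_of_mem hj)
    have hih := ih ha' hb' hab'
    have hM0 : 0 ≤ M := zero_le_one.trans hM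
    have hbprod : |∏ j ∈ s, b j| ≤ M ^ s.card := by
      rw [Finset.abs_prod]
      calc ∏ j ∈ s, |b j| ≤ ∏ _j ∈ s, M := Finset.prod_le_prod (fun _ _ => abs_nonneg _) hb'
        _ = M ^ s.card := Finset.prod_const M
    rw [Finset.prod_insert hi, Finset.prod_insert hi, Finset.card_insert_of_notMem hi]
    have hsplit : a i * ∏ j ∈ s, a j - b i * ∏ j ∈ s, b j =
        a i * (∏ j ∈ s, a j - ∏ j ∈ s, b j) + (a i - b i) * ∏ j ∈ s, b j := by ring
    rw [hsplit]
    calc |a i * (∏ j ∈ s, a j - ∏ j ∈ s, b j) + (a i - b i) * ∏ j ∈ s, b j|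
        ≤ |a i| * |∏ j ∈ s, a j - ∏ j ∈ s, b j| + |a i - b i| * |∏ j ∈ s, b j| := by
          refine (abs_add_le _ _).trans ?_
          rw [abs_mul, abs_mul]
      _ ≤ M * (s.card * M ^ s.card * η) + η * M ^ s.card :=
          add_le_add (mul_le_mul (ha i (mem_insert_self i s)) hih (abs_nonneg _) hM0)
            (mul_le_mul (hab i (mem_insert_self i s)) hbprod (abs_nonneg _) hη)
      _ ≤ ((s.card + 1 : ℕ) : ℝ) * M ^ (s.card + 1) * η := by
          push_cast
          rw [pow_succ]
          have h1 : η * M ^ s.card ≤ η * M ^ s.card * M := le_mul_of_one_le_right (by positivity) hM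
          nlinarith [h1, pow_nonneg hM0 s.card]

/-! ### The supremum of a density profile is at least one -/

/-- `1 ≤ M` for a density profile (`1 = ∫ β ≤ ∫ M = M`). -/
theorem one_le_M (P : DensityProfile) : 1 ≤ P.M := by
  calc (1 : ℝ) = ∫ y, P.β y := P.integral_eq_one.symm
    _ ≤ ∫ _ : T3, P.M := integral_mono (integrable_T3 P.continuous) (integrable_const _) P.le_M
    _ = P.M := by simp

/-! ### Uniform convergence of the rescaled cluster integrand -/

/-- **The rescaled cluster integrand is uniformly close to its limit**: if `β` varies by at most
`η` on minimal-image balls of radius `k ε` (`0 ≤ ε`, `0 ≤ η`), then for every `y₀`,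
`|J_ε(y₀) - b_k β(y₀)^k| ≤ k η ∫ domF` (on the support of the unit-scale Ursell coefficient all
lifted points are within `k` of the origin, `norm_le_of_cE_ne_zero`). -/
theorem abs_Jint_sub_le (P : DensityProfile) (k : ℕ) {ε η : ℝ} (hε : 0 ≤ ε) (hη : 0 ≤ η)
    (hmod : ∀ x y : T3, euclidDist y x ≤ k * ε → |P.β y - P.β x| ≤ η) (y0 : T3) :
    |Jint P ε k y0 - bE k * P.β y0 ^ k| ≤ k * η * ∫ z, domF P k z := by
  have hM1 := one_le_M P
  have hM0 : 0 ≤ P.M := zero_le_one.trans hM1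
  -- both integrals
  have hint1 : Integrable fun z : Fin k → E3 => cE 1 z * ∏ j, P.β (y0 + Torus.proj (ε • z j)) :=
    (integrable_domF P k).mono' (measurable_integrand P k ε y0).aestronglyMeasurable
      (ae_of_all _ fun z => (Real.norm_eq_abs _).le.trans (abs_integrand_le_domF P k ε y0 z))
  have hint2 : Integrable fun z : Fin k → E3 => cE 1 z * P.β y0 ^ k := by
    have h := (integrable_domF P k).mono' (measurable_integrand P k 0 y0).aestronglyMeasurable
      (ae_of_all _ fun z => (Real.norm_eq_abs _).le.trans (abs_integrand_le_domF P k 0 y0 z))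
    refine h.congr (ae_of_all _ fun z => ?_)
    simp [Literature.Analysis.FunctionSpaces.Torus.proj_zero]
  have hrepr : Jint P ε k y0 - bE k * P.β y0 ^ k =
      ∫ z : Fin k → E3, cE 1 z * ((∏ j, P.β (y0 + Torus.proj (ε • z j))) - P.β y0 ^ k) := by
    rw [Jint, bE, ← integral_mul_const, ← integral_sub hint1 hint2]
    refine integral_congr_ae (ae_of_all _ fun z => ?_)
    ring
  rw [hrepr]
  -- pointwise bound by `k η domF / (U M^k) · U M^k`-free form: `|…| ≤ k η 𝟙[suppBox] U M^k`
  have hpt : ∀ z : Fin k → E3,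
      |cE 1 z * ((∏ j, P.β (y0 + Torus.proj (ε • z j))) - P.β y0 ^ k)| ≤ k * η * domF P k z := by
    intro z
    by_cases hc : cE 1 z = 0
    · rw [hc, zero_mul, abs_zero]
      unfold domF
      refine mul_nonneg (by positivity) (Set.indicator_nonneg (fun _ _ => by positivity) z)
    · unfold domF
      rw [Set.indicator_of_mem (mem_suppBox_of_cE_ne_zero hc), abs_mul]
      have hprod : P.β y0 ^ k = ∏ _j : Fin k, P.β y0 := by simp
      have hdiff : |(∏ j, P.β (y0 + Torus.proj (ε • z j))) - P.β y0 ^ k| ≤ k * P.M ^ k * η := by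
        rw [hprod]
        have h := abs_prod_sub_prod_le (univ : Finset (Fin k))
          (a := fun j => P.β (y0 + Torus.proj (ε • z j))) (b := fun _ => P.β y0) hM1 hη
          (fun j _ => (abs_of_pos (P.pos _)).trans_le (P.le_M _))
          (fun j _ => (abs_of_pos (P.pos _)).trans_le (P.le_M _))
          (fun j _ => hmod y0 _ ?_)
        · simpa using h
        · refine (euclidDist_add_proj_le y0 (ε • z j)).trans ?_
          rw [norm_smul, Real.norm_of_nonneg hε, mul_comm]
          exact mul_le_mul_of_nonneg_right (by simpa using norm_le_of_cE_ne_zero zero_le_one hc j) hε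
      calc |cE 1 z| * |(∏ j, P.β (y0 + Torus.proj (ε • z j))) - P.β y0 ^ k|
          ≤ (hcUrsellBound (univ : Finset (Fin (k + 1))) : ℝ) * (k * P.M ^ k * η) :=
            mul_le_mul (abs_cE_le 1 z) hdiff (abs_nonneg _) (Nat.cast_nonneg _)
        _ = k * η * ((hcUrsellBound (univ : Finset (Fin (k + 1))) : ℝ) * P.M ^ k) := by ring
  calc |∫ z : Fin k → E3, cE 1 z * ((∏ j, P.β (y0 + Torus.proj (ε • z j))) - P.β y0 ^ k)|
      ≤ ∫ z : Fin k → E3, |cE 1 z * ((∏ j, P.β (y0 + Torus.proj (ε • z j))) - P.β y0 ^ k)| :=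
        abs_integral_le_integral_abs
    _ ≤ ∫ z : Fin k → E3, k * η * domF P k z :=
        integral_mono_of_nonneg (ae_of_all _ fun z => abs_nonneg _)
          ((integrable_domF P k).const_mul _) (ae_of_all _ hpt)
    _ = k * η * ∫ z, domF P k z := integral_const_mul _ _

end

end Summit.AtomisticToContinuum.HydrodynamicLimit.Theorems.MesoLLN
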